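import Mathlib
import Summits.ValiantsHypothesis.ValiantsHypothesis.Statement
import Summits.ValiantsHypothesis.ValiantsHypothesis.Theorems.SoloInformedQuadSpanWindow
import Literature.Combinatorics.SimpleGraph.BondySimonovitsProofs
import HarnessLib

/-!
# Soloist (informed) rung: the asymmetric sumset girth bound (quadspan 2.61)

Session s34 of the soloist programme `solo-ValiantsHypothesis-informed`.

`soloInformed_sumsetGirth` (s32) bounds a `(K,h)`-free `E ⊆ A + A` by `|A| + 86k|A|^{1+1/k}`.
Here the two summands play different roles: if every `e ∈ E` is written `e = x e + v e` with the
SECOND summand in a set `V`, then `|E| ≤ |x(E)| + 86 k |V|^{1+1/k}` — linear in the number of first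
summands, a power only of `|V|`.  This is the combinatorial core of the partner half of the
vector-proliferation step `n → s` (quadspan 2.60; kernel form in `SoloInformedBundleGirth`).

* `solo_not_free_of_balanced` — a balanced `±1` relation `Σ_{i<n} lm i = Σ_{i<n} lp i` on members
  of `E`, injective on each side and with some `lm i₀` surviving cancellation, contradicts
  `SoloNatFree K h E` (`2n ≤ K`, `1 ≤ h`).
* `soloInformed_asymSumsetGirth` — the bound.  Proof: the fibre `P_a = {v e : x e = a} ⊆ V`
  contributes `1 + (|P_a| - 1)`; the stars `{min P_a, w}`, `w ∈ P_a ∖ {min P_a}`, are pairwise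
  distinct edges of a simple graph on `V` (two fibres sharing two elements give a `4`-term
  relation), and a cycle of length exactly `2k` in that graph (Bondy–Simonovits,
  `evenCycle_of_manyEdges`) gives a balanced `±1` relation on `≤ 4k` members of `E`: consecutive
  cycle edges lying in stars of the same fibre cancel in pairs, but three consecutive edges never
  lie in one star, so the relation is nontrivial.

PATH TO THE SUMMIT.  See `SoloInformedBundleGirth`: with `V` the set of column orders
(`|V| ≤ dim W`) this converts the partner side of the rank-2 case of the hypothesis `hQ` of
`soloInformed_valiantsHypothesis_of_unipolyLogOrderBound` from vectors to dimension; the owner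
side ((VB″), owner proliferation) remains open.

References: Bondy–Simonovits, JCTB 16 (1974) 97–105 (Literature `BondySimonovits1974`); soloist
notes `paper/quadspan.md` 2.60–2.61, `paper/sharpest.md` §9.12–9.13.
-/

namespace Summit.ValiantsHypothesis.ValiantsHypothesis.Theorems

open Finset

/-- A balanced `±1` relation contradicts freeness: if `lm, lp : ℕ → ℕ` take values in `E` for
`i < n`, are injective there, `Σ_{i<n} lm i = Σ_{i<n} lp i`, and some `lm i₀` differs from every
`lp j`, then `E` is not `(K,h)`-free when `2n ≤ K`, `1 ≤ h`. -/
theorem solo_not_free_of_balanced {K h n : ℕ} (hK : 2 * n ≤ K) (hh : 1 ≤ h) {E : Finset ℕ}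
    (hfree : SoloNatFree K h E) (lm lp : ℕ → ℕ)
    (hlmE : ∀ i < n, lm i ∈ E) (hlpE : ∀ i < n, lp i ∈ E)
    (hlm : ∀ i < n, ∀ j < n, lm i = lm j → i = j)
    (hlp : ∀ i < n, ∀ j < n, lp i = lp j → i = j)
    (hsum : ∑ i ∈ range n, (lm i : ℤ) = ∑ i ∈ range n, (lp i : ℤ))
    (hgood : ∃ i < n, ∀ j < n, lm i ≠ lp j) : False := by
  classical
  set A : ℕ → ℤ := fun e => ∑ i ∈ range n, if lm i = e then 1 else 0 with hA
  set B : ℕ → ℤ := fun e => ∑ i ∈ range n, if lp i = e then 1 else 0 with hB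
  have hA' : ∀ e, A e = (((range n).filter fun i => lm i = e).card : ℤ) := fun e => by
    simp only [hA, sum_boole]
  have hB' : ∀ e, B e = (((range n).filter fun i => lp i = e).card : ℤ) := fun e => by
    simp only [hB, sum_boole]
  have hle1 : ∀ l : ℕ → ℕ, (∀ i < n, ∀ j < n, l i = l j → i = j) →
      ∀ e, ((range n).filter fun i => l i = e).card ≤ 1 := fun l hl e => by
    rw [card_le_one]
    intro i hi j hj
    rw [mem_filter, mem_range] at hi hj
    exact hl i hi.1 j hj.1 (hi.2.trans hj.2.symm)
  have hAeq : ∀ i < n, A (lm i) = 1 := by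
    intro i hi
    have hs : ((range n).filter fun j => lm j = lm i) = {i} := by
      ext j
      simp only [mem_filter, mem_range, mem_singleton]
      exact ⟨fun hj => hlm j hj.1 i hi hj.2, fun hj => by subst hj; exact ⟨hi, rfl⟩⟩
    rw [hA', hs, card_singleton, Nat.cast_one]
  have hB0 : ∀ e, (∀ j < n, lp j ≠ e) → B e = 0 := fun e he =>
    sum_eq_zero fun j hj => if_neg (he j (mem_range.mp hj))
  set c : ℕ → ℤ := fun e => A e - B e with hc
  have hc_abs : ∀ e, |c e| ≤ h := fun e => by
    have h1 : A e ≤ 1 := by rw [hA']; exact_mod_cast hle1 lm hlm e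
    have h2 : 0 ≤ A e := by rw [hA']; positivity
    have h3 : B e ≤ 1 := by rw [hB']; exact_mod_cast hle1 lp hlp e
    have h4 : 0 ≤ B e := by rw [hB']; positivity
    have h5 : (1 : ℤ) ≤ h := by exact_mod_cast hh
    show |A e - B e| ≤ h
    rw [abs_le]
    constructor <;> linarith
  have hsupp : (E.filter fun e => c e ≠ 0).card ≤ K := by
    have hsub : (E.filter fun e => c e ≠ 0) ⊆ (range n).image lm ∪ (range n).image lp := by
      intro e he
      rw [mem_filter] at he
      by_contra hne
      rw [mem_union, not_or, mem_image, mem_image, not_exists, not_exists] at hne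
      have hA0 : A e = 0 := sum_eq_zero fun i hi => if_neg fun h => hne.1 i ⟨hi, h⟩
      have hB0' : B e = 0 := sum_eq_zero fun i hi => if_neg fun h => hne.2 i ⟨hi, h⟩
      exact he.2 (show A e - B e = 0 by rw [hA0, hB0', sub_zero])
    calc (E.filter fun e => c e ≠ 0).card
        ≤ ((range n).image lm ∪ (range n).image lp).card := card_le_card hsub
      _ ≤ ((range n).image lm).card + ((range n).image lp).card := card_union_le _ _
      _ ≤ (range n).card + (range n).card := add_le_add card_image_le card_image_le
      _ = 2 * n := by rw [card_range]; ring
      _ ≤ K := hK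
  have hXsum : ∀ l : ℕ → ℕ, (∀ i < n, l i ∈ E) →
      ∑ e ∈ E, (∑ i ∈ range n, if l i = e then (1 : ℤ) else 0) * (e : ℤ) =
        ∑ i ∈ range n, (l i : ℤ) := by
    intro l hl
    calc ∑ e ∈ E, (∑ i ∈ range n, if l i = e then (1 : ℤ) else 0) * (e : ℤ)
        = ∑ e ∈ E, ∑ i ∈ range n, (if l i = e then (1 : ℤ) else 0) * (e : ℤ) :=
          sum_congr rfl fun e _ => by rw [Finset.sum_mul]
      _ = ∑ i ∈ range n, ∑ e ∈ E, (if l i = e then (1 : ℤ) else 0) * (e : ℤ) := sum_comm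
      _ = ∑ i ∈ range n, (l i : ℤ) := by
          refine sum_congr rfl fun i hi => ?_
          rw [sum_eq_single (l i)]
          · simp
          · intro e _ hne
            rw [if_neg (Ne.symm hne), zero_mul]
          · intro h
            exact absurd (hl i (mem_range.mp hi)) h
  have hsum0 : (∑ e ∈ E, c e * (e : ℤ)) = 0 := by
    calc (∑ e ∈ E, c e * (e : ℤ))
        = ∑ e ∈ E, (A e * (e : ℤ) - B e * (e : ℤ)) :=
          sum_congr rfl fun e _ => by show (A e - B e) * (e : ℤ) = _; ring
      _ = ∑ e ∈ E, A e * (e : ℤ) - ∑ e ∈ E, B e * (e : ℤ) := sum_sub_distrib _ _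
      _ = 0 := by rw [hA, hB, hXsum lm hlmE, hXsum lp hlpE, hsum, sub_self]
  obtain ⟨i₀, hi₀, hgood₀⟩ := hgood
  have h0 := hfree c hsupp hc_abs hsum0 (lm i₀) (hlmE i₀ hi₀)
  have h1 : c (lm i₀) = 1 := by
    show A (lm i₀) - B (lm i₀) = 1
    rw [hAeq i₀ hi₀, hB0 (lm i₀) (fun j hj h => hgood₀ j hj h.symm), sub_zero]
  rw [h1] at h0
  exact one_ne_zero h0

/-- **Asymmetric sumset girth bound** (quadspan 2.61).  If every `e ∈ E` is decomposed as
`e = x e + v e` with `v e ∈ V`, and `E ⊂ ℕ` carries no nontrivial `±`-relation of support `≤ K`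
and height `≤ h` (`SoloNatFree K h E`) with `4k ≤ K`, `1 ≤ k`, `1 ≤ h`, then
`|E| ≤ |x(E)| + 86 k |V|^{1 + 1/k}` — linear in the number of first summands, super-linear
only in the number of second summands. -/
theorem soloInformed_asymSumsetGirth {K h k : ℕ} (hk : 1 ≤ k) (hK : 4 * k ≤ K) (hh : 1 ≤ h)
    (E V : Finset ℕ) (x v : ℕ → ℕ) (hvV : ∀ e ∈ E, v e ∈ V)
    (hxv : ∀ e ∈ E, x e + v e = e) (hfree : SoloNatFree K h E) :
    (E.card : ℝ) ≤ (E.image x).card + 86 * k * (V.card : ℝ) ^ (1 + 1 / (k : ℝ)) := by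
  classical
  set X : Finset ℕ := E.image x with hX
  set P : ℕ → Finset ℕ := fun a => (E.filter fun e => x e = a).image v with hP
  have hPE : ∀ a w, w ∈ P a → a + w ∈ E ∧ x (a + w) = a ∧ v (a + w) = w := by
    intro a w hw
    simp only [hP, mem_image, mem_filter] at hw
    obtain ⟨e, ⟨he, hxe⟩, hve⟩ := hw
    have hae : a + w = e := by rw [← hxe, ← hve]; exact hxv e he
    rw [hae]
    exact ⟨he, hxe, hve⟩
  have hPV : ∀ a, P a ⊆ V := by
    intro a w hw
    simp only [hP, mem_image, mem_filter] at hw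
    obtain ⟨e, ⟨he, -⟩, rfl⟩ := hw
    exact hvV e he
  have hPne : ∀ a ∈ X, (P a).Nonempty := by
    intro a ha
    rw [hX, mem_image] at ha
    obtain ⟨e, he, rfl⟩ := ha
    exact ⟨v e, by simp only [hP]; exact mem_image.mpr ⟨e, mem_filter.mpr ⟨he, rfl⟩, rfl⟩⟩
  -- `|E| = Σ_{a ∈ X} |P a| = |X| + Σ_{a ∈ X} |P a ∖ {min P a}|`
  have hcardE : E.card = ∑ a ∈ X, (P a).card := by
    rw [hX, card_eq_sum_card_image x E]
    refine sum_congr rfl fun a _ => ?_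
    simp only [hP]
    refine (card_image_of_injOn fun e he e' he' hvv => ?_).symm
    simp only [coe_filter, Set.mem_setOf_eq] at he he'
    rw [← hxv e he.1, ← hxv e' he'.1, he.2, he'.2, hvv]
  set mn : ℕ → ℕ := fun a => if hne : (P a).Nonempty then (P a).min' hne else 0 with hmn
  have hmn_mem : ∀ a ∈ X, mn a ∈ P a := by
    intro a ha
    simp only [hmn, dif_pos (hPne a ha)]
    exact min'_mem _ _
  have hsplit : ∑ a ∈ X, (P a).card = X.card + ∑ a ∈ X, ((P a).erase (mn a)).card := by
    rw [card_eq_sum_ones X, ← sum_add_distrib]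
    refine sum_congr rfl fun a ha => ?_
    rw [card_erase_of_mem (hmn_mem a ha)]
    have := card_pos.mpr ⟨mn a, hmn_mem a ha⟩
    omega
  set St := X.sigma fun a => (P a).erase (mn a) with hSt
  have hSt_card : St.card = ∑ a ∈ X, ((P a).erase (mn a)).card := by rw [hSt, card_sigma]
  have hSt_mem : ∀ z ∈ St, z.1 ∈ X ∧ z.2 ∈ P z.1 ∧ z.2 ≠ mn z.1 := by
    intro z hz
    rw [hSt, mem_sigma] at hz
    exact ⟨hz.1, mem_of_mem_erase hz.2, ne_of_mem_erase hz.2⟩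
  suffices hmain : (St.card : ℝ) ≤ 86 * k * (V.card : ℝ) ^ (1 + 1 / (k : ℝ)) by
    have h1 : (E.card : ℝ) = X.card + St.card := by
      rw [hcardE, hsplit, hSt_card]; push_cast; ring
    linarith
  by_contra hlt
  have hlt := not_le.mp hlt
  set N := V.card with hN
  have hpos : (0 : ℝ) ≤ 86 * k * (N : ℝ) ^ (1 + 1 / (k : ℝ)) := by positivity
  have hN1 : 1 ≤ N := by
    have h0 : (0 : ℝ) < St.card := hpos.trans_lt hlt
    obtain ⟨z, hz⟩ := card_pos.mp (by exact_mod_cast h0)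
    exact card_pos.mpr ⟨_, hPV _ (hSt_mem z hz).2.1⟩
  -- vertices `Fin N ≃ V`
  let φ : ↥V ≃ Fin N := V.equivFin
  let val : Fin N → ℕ := fun z => ((φ.symm z : ↥V) : ℕ)
  have hval_inj : Function.Injective val := fun z y hzy => φ.symm.injective (Subtype.ext hzy)
  let ι : ℕ → Fin N := fun a => if ha : a ∈ V then φ ⟨a, ha⟩ else ⟨0, hN1⟩
  have hval_ι : ∀ a ∈ V, val (ι a) = a := by
    intro a ha
    simp [val, ι, ha]
  have hι : ∀ a ∈ V, ∀ b ∈ V, ι a = ι b → a = b := fun a ha b hb hab => by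
    rw [← hval_ι a ha, ← hval_ι b hb, hab]
  -- the star graph on `V`
  let G : SimpleGraph (Fin N) :=
    { Adj := fun z y => z ≠ y ∧ ∃ a ∈ X, (val z = mn a ∧ val y ∈ P a) ∨ (val y = mn a ∧ val z ∈ P a)
      symm := ⟨fun z y hzy => ⟨hzy.1.symm, by
        obtain ⟨a, ha, h2⟩ := hzy.2
        exact ⟨a, ha, h2.symm⟩⟩⟩
      loopless := ⟨fun z hz => hz.1 rfl⟩ }
  -- two distinct fibres never share two elements (a `4`-term relation)
  have hshare : ∀ a ∈ X, ∀ a' ∈ X, ∀ w₁ w₂ : ℕ, w₁ ≠ w₂ →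
      w₁ ∈ P a → w₂ ∈ P a → w₁ ∈ P a' → w₂ ∈ P a' → a = a' := by
    intro a ha a' ha' w₁ w₂ hne i1 i2 j1 j2
    by_contra haa
    obtain ⟨e1E, e1x, -⟩ := hPE _ _ i1
    obtain ⟨e2E, e2x, -⟩ := hPE _ _ i2
    obtain ⟨e3E, e3x, -⟩ := hPE _ _ j1
    obtain ⟨e4E, e4x, -⟩ := hPE _ _ j2
    have d14 : a + w₁ ≠ a' + w₂ := fun h => haa (by rw [← e1x, h, e4x])
    have d23 : a + w₂ ≠ a' + w₁ := fun h => haa (by rw [← e2x, h, e3x])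
    refine solo_not_free_of_balanced (n := 2) (by omega) hh hfree
      (fun i => if i = 0 then a + w₁ else a' + w₂)
      (fun i => if i = 0 then a + w₂ else a' + w₁) ?_ ?_ ?_ ?_ ?_ ?_
    · intro i hi
      interval_cases i <;> simp [e1E, e4E]
    · intro i hi
      interval_cases i <;> simp [e2E, e3E]
    · intro i hi j hj hij
      interval_cases i <;> interval_cases j <;> simp at hij ⊢ <;> omega
    · intro i hi j hj hij
      interval_cases i <;> interval_cases j <;> simp at hij ⊢ <;> omega
    · simp [sum_range_succ]
      ring
    · refine ⟨0, by omega, fun j hj => ?_⟩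
      interval_cases j <;> simp <;> omega
  -- the stars are pairwise distinct edges of `G`
  let edgeOf : (Σ _ : ℕ, ℕ) → Sym2 (Fin N) := fun z => s(ι (mn z.1), ι z.2)
  have hedge : (St.card : ℝ) ≤ (G.edgeSet.ncard : ℝ) := by
    have hmem : ∀ z ∈ St, edgeOf z ∈ G.edgeSet := by
      intro z hz
      obtain ⟨h1, h2, h3⟩ := hSt_mem z hz
      have hm : mn z.1 ∈ V := hPV _ (hmn_mem _ h1)
      have hw : z.2 ∈ V := hPV _ h2
      show s(ι (mn z.1), ι z.2) ∈ G.edgeSet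
      rw [SimpleGraph.mem_edgeSet]
      exact ⟨fun heq => h3 (hι _ hm _ hw heq).symm, z.1, h1,
        Or.inl ⟨hval_ι _ hm, by rw [hval_ι _ hw]; exact h2⟩⟩
    have hinj : Set.InjOn edgeOf ↑St := by
      intro z hz z' hz' hzz
      obtain ⟨h1, h2, h3⟩ := hSt_mem z hz
      obtain ⟨h1', h2', h3'⟩ := hSt_mem z' hz'
      have hm : mn z.1 ∈ V := hPV _ (hmn_mem _ h1)
      have hw : z.2 ∈ V := hPV _ h2
      have hm' : mn z'.1 ∈ V := hPV _ (hmn_mem _ h1')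
      have hw' : z'.2 ∈ V := hPV _ h2'
      have hcases : (mn z.1 = mn z'.1 ∧ z.2 = z'.2) ∨ (mn z.1 = z'.2 ∧ z.2 = mn z'.1) := by
        rcases Sym2.eq_iff.mp hzz with ⟨ha, hb⟩ | ⟨ha, hb⟩
        · exact Or.inl ⟨hι _ hm _ hm' ha, hι _ hw _ hw' hb⟩
        · exact Or.inr ⟨hι _ hm _ hw' ha, hι _ hw _ hm' hb⟩
      have hfst : z.1 = z'.1 := by
        rcases hcases with ⟨ha, hb⟩ | ⟨ha, hb⟩
        · exact hshare _ h1 _ h1' (mn z.1) z.2 h3.symm (hmn_mem _ h1) h2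
            (ha ▸ hmn_mem _ h1') (hb ▸ h2')
        · exact hshare _ h1 _ h1' (mn z.1) z.2 h3.symm (hmn_mem _ h1) h2
            (ha ▸ h2') (hb ▸ hmn_mem _ h1')
      rcases hcases with ⟨-, hb⟩ | ⟨ha, hb⟩
      · exact Sigma.ext hfst (heq_of_eq hb)
      · exfalso
        apply h3'
        rw [← ha, hfst]
    have hcard : (St.image edgeOf).card = St.card := card_image_of_injOn hinj
    have hsub : (↑(St.image edgeOf) : Set (Sym2 (Fin N))) ⊆ G.edgeSet := by
      intro z hz
      rw [Finset.coe_image] at hz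
      obtain ⟨e, he, rfl⟩ := hz
      exact hmem e he
    have h := Set.ncard_le_ncard hsub G.edgeSet.toFinite
    rw [Set.ncard_coe_finset, hcard] at h
    exact_mod_cast h
  -- Bondy–Simonovits: a cycle of length exactly `2k` in the star graph
  have hE' : (86 : ℝ) * k * (N : ℝ) ^ (1 + 1 / (k : ℝ)) < (G.edgeSet.ncard : ℝ) :=
    lt_of_lt_of_le hlt hedge
  have hlk : (k : ℝ) ≤ k * (N : ℝ) ^ (1 / (k : ℝ)) := by
    have h1 : (1 : ℝ) ≤ (N : ℝ) ^ (1 / (k : ℝ)) :=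
      Real.one_le_rpow (by exact_mod_cast hN1) (by positivity)
    have hk0 : (0 : ℝ) ≤ k := by positivity
    nlinarith
  obtain ⟨u, p, hcyc, hlen⟩ :=
    Literature.Combinatorics.SimpleGraph.BondySimonovits1974.evenCycle_of_manyEdges 86
      (by norm_num) k N hk G hE' k le_rfl hlk
  have h3 : 3 ≤ p.length := hcyc.isCircuit.three_le_length
  have hk2 : 2 ≤ k := by omega
  let vv : ℕ → Fin N := fun i => p.getVert i
  have hadj : ∀ i < 2 * k, G.Adj (vv i) (vv (i + 1)) :=
    fun i hi => p.adj_getVert_succ (by rw [hlen]; exact hi)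
  -- the fibre of each cycle edge, with its centre
  have hfib : ∀ i, ∃ a, i < 2 * k → a ∈ X ∧ val (vv i) ∈ P a ∧ val (vv (i + 1)) ∈ P a ∧
      (val (vv i) = mn a ∨ val (vv (i + 1)) = mn a) := by
    intro i
    by_cases hi : i < 2 * k
    · obtain ⟨a, ha, h2⟩ := (hadj i hi).2
      refine ⟨a, fun _ => ⟨ha, ?_⟩⟩
      rcases h2 with ⟨h5, h4⟩ | ⟨h5, h4⟩
      · exact ⟨h5 ▸ hmn_mem a ha, h4, Or.inl h5⟩
      · exact ⟨h4, h5 ▸ hmn_mem a ha, Or.inr h5⟩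
    · exact ⟨0, fun h => absurd h hi⟩
  choose bsel hbsel using hfib
  have hinj0 := hcyc.getVert_injOn'
  have hinj1 := hcyc.getVert_injOn
  have hvinj : ∀ i < 2 * k, ∀ j < 2 * k, vv i = vv j → i = j := fun i hi j hj hij =>
    hinj0 (by simp; omega) (by simp; omega) hij
  have hvinj' : ∀ i < 2 * k, ∀ j < 2 * k, vv i = vv (j + 1) →
      i = j + 1 ∨ (i = 0 ∧ j + 1 = 2 * k) := by
    intro i hi j hj hij
    by_cases hj' : j + 1 < 2 * k
    · exact Or.inl (hinj0 (by simp; omega) (by simp; omega) hij)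
    · right
      have hj2 : j + 1 = 2 * k := by omega
      have hu : p.getVert i = u := by
        show vv i = u
        rw [hij]
        show p.getVert (j + 1) = u
        rw [hj2, ← hlen]
        exact p.getVert_length
      have := (hcyc.getVert_endpoint_iff (by rw [hlen]; omega)).mp hu
      omega
  have h4k : 2 * (2 * k) ≤ K := by omega
  refine solo_not_free_of_balanced h4k hh hfree
    (fun i => bsel i + val (vv i)) (fun i => bsel i + val (vv (i + 1))) ?_ ?_ ?_ ?_ ?_ ?_
  · exact fun i hi => (hPE _ _ (hbsel i hi).2.1).1
  · exact fun i hi => (hPE _ _ (hbsel i hi).2.2.1).1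
  · intro i hi j hj hij
    have e1 := hPE _ _ (hbsel i hi).2.1
    have e2 := hPE _ _ (hbsel j hj).2.1
    have hv : val (vv i) = val (vv j) := by rw [← e1.2.2, hij, e2.2.2]
    exact hvinj i hi j hj (hval_inj hv)
  · intro i hi j hj hij
    have e1 := hPE _ _ (hbsel i hi).2.2.1
    have e2 := hPE _ _ (hbsel j hj).2.2.1
    have hv : val (vv (i + 1)) = val (vv (j + 1)) := by rw [← e1.2.2, hij, e2.2.2]
    have := hinj1 (by simp; omega) (by simp; omega) (hval_inj hv)
    omega
  · have hv0 : vv (2 * k) = vv 0 := by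
      show p.getVert (2 * k) = p.getVert 0
      rw [← hlen, p.getVert_length, p.getVert_zero]
    have htel := Finset.sum_range_sub' (fun i => (val (vv i) : ℤ)) (2 * k)
    simp only [hv0, sub_self] at htel
    have hsd := Finset.sum_sub_distrib (s := range (2 * k)) (fun i => (val (vv i) : ℤ))
      (fun i => (val (vv (i + 1)) : ℤ))
    simp only [Nat.cast_add, sum_add_distrib]
    linarith
  · -- three consecutive cycle edges never lie in one star
    by_contra hbad
    push Not at hbad
    have step : ∀ i, 1 ≤ i → i < 2 * k → bsel i = bsel (i - 1) := by
      intro i hi1 hi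
      obtain ⟨j, hj, hij⟩ := hbad i hi
      have e1 := hPE _ _ (hbsel i hi).2.1
      have e2 := hPE _ _ (hbsel j hj).2.2.1
      have hb : bsel i = bsel j := by rw [← e1.2.1, hij, e2.2.1]
      have hv : vv i = vv (j + 1) := hval_inj (by rw [← e1.2.2, hij, e2.2.2])
      rcases hvinj' i hi j hj hv with h5 | ⟨h5, -⟩
      · have hj1 : j = i - 1 := by omega
        rw [hb, hj1]
      · omega
    have h10 : bsel 1 = bsel 0 := step 1 le_rfl (by omega)
    have h21 : bsel 2 = bsel 1 := step 2 (by omega) (by omega)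
    have c0 := (hbsel 0 (by omega)).2.2.2
    have c2 := (hbsel 2 (by omega)).2.2.2
    rw [h21, h10] at c2
    have d : ∀ i < 2 * k, ∀ j < 2 * k, i ≠ j → val (vv i) ≠ val (vv j) :=
      fun i hi j hj hij h => hij (hvinj i hi j hj (hval_inj h))
    rcases c0 with h0 | h0 <;> rcases c2 with h2 | h2
    · exact d 0 (by omega) 2 (by omega) (by omega) (h0.trans h2.symm)
    · exact d 0 (by omega) 3 (by omega) (by omega) (h0.trans h2.symm)
    · exact d 1 (by omega) 2 (by omega) (by omega) (h0.trans h2.symm)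
    · exact d 1 (by omega) 3 (by omega) (by omega) (h0.trans h2.symm)

end Summit.ValiantsHypothesis.ValiantsHypothesis.Theorems
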